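import Summits.Ventures.Crystal3D.Theorems.StickyWulffConstantCoaxialWallLawPayerTwinTwoPlateRow
import Summits.Ventures.Crystal3D.Theorems.StickyWulffConstantCoaxialWallLawVicinalSplit
import Summits.Ventures.Crystal3D.Theorems.StickyWulffConstantCoaxialWallLawInPlaneStackWalkers
import HarnessLib

/-!
# Debt 1 of the vicinal split, `CoaxialTwoSlabAdhesionCoherentTwin`, FROM THE TWIN CENSUS ROW

HONEST FRAMING. Venture `Summits/Ventures/Crystal3D` (cell `crystal3d-full`), helper `--supports` the crux
`CoaxialWallLaw` (stmt-Ventures-19481, `route-Ventures-StickyWulffConstant`), REGISTERED line `WallLedgerF`, open stub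
`stub_coaxialTwoSlabAdhesion`.  Rung credit; F-C1 not moved; CONDITIONAL on named facts.  cf-p1 g28 16:59:06Z RE-AIM
(19481-p2 g6): 19481-p1 g11's typed split (`…VicinalSplit`, p648523) owes three debts; Debt 1 — the vicinal COHERENT Σ3
TWINS — is the twin census row's: `coaxialTwoSlabAdhesion_general_twin_of_row` (`…PayerTwinTwoPlateRow`) proves the stub's
conclusion for EVERY twin pair (`A₁·Λ₀ ≠ A₂·Λ₀`), so all this file adds is that a coherent twin pair IS a twin pair
(`image_ne_twinFrame`: the fcc lattice is not its own `{111}` mirror — by the word-rigidity lemma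
`map_reflection_eq_of_image_eq` with the empty word against the one-letter word) and the bookkeeping of the two normal
forms of the frame family.

* `image_ne_twinFrame`, **`coaxialTwoSlabAdhesionCoherentTwin_of_row`** :
  `KissingGap δ → KissingClassification δ → 0 < s_F ≤ 2√6 → (twin half-turn rows, v1, s_F) → CoaxialTwoSlabAdhesionCoherentTwin`.

INPUTS BY NAME: `KissingGap`, `KissingClassification`, the twin rows `∀ L, LocalEndRow v1 s_F ⟨L, inPlaneRoots L 1⟩
⟨(ℝ∙e₃).reflection ∘ L, inPlaneRoots (…) (−1)⟩` (= `EndRowTwinHalfTurn v1 s_F` once the `…EndRowDefs` append lands).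
WHAT THIS IS NOT: not the row; Debts 2, 3 untouched; F-C1 not moved.
-/

noncomputable section

namespace Summit.Ventures.Crystal3D.Theorems

open Summit.Ventures.Crystal3D Finset
open Literature.MathematicalPhysics.StatisticalMechanics (fccStacking barlowStacking IsHaggSeq)
open scoped InnerProductSpace

/-- **The fcc lattice is not its own `{111}` twin**: `A₁·Λ₀ ≠ twinFrame A₁ ν · Λ₀` for a unit menu normal `ν` of `A₁`. -/
theorem image_ne_twinFrame (A₁ : EuclideanSpace ℝ (Fin 3) ≃ₗᵢ[ℝ] EuclideanSpace ℝ (Fin 3))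
    {ν : EuclideanSpace ℝ (Fin 3)} (hν1 : ‖ν‖ = 1)
    (hmenu : ∀ w ∈ fccSlots, ⟪A₁ w, ν⟫_ℝ = 0 ∨ ⟪A₁ w, ν⟫_ℝ = Real.sqrt (2 / 3) ∨ ⟪A₁ w, ν⟫_ℝ = -Real.sqrt (2 / 3)) :
    A₁ '' fccStacking 1 (Real.sqrt (2 / 3)) ≠ twinFrame A₁ ν '' fccStacking 1 (Real.sqrt (2 / 3)) := by
  intro hEq
  set μ : EuclideanSpace ℝ (Fin 3) := A₁.symm ν with hμ
  have hAμ : A₁ μ = ν := A₁.apply_symm_apply ν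
  have hμ1 : ‖μ‖ = 1 := by rw [hμ, LinearIsometryEquiv.norm_map, hν1]
  have hμmenu : ∀ w ∈ fccSlots, ⟪w, μ⟫_ℝ = 0 ∨ ⟪w, μ⟫_ℝ = Real.sqrt (2 / 3) ∨ ⟪w, μ⟫_ℝ = -Real.sqrt (2 / 3) := by
    intro w hw
    have := hmenu w hw
    rwa [← hAμ, LinearIsometryEquiv.inner_map_map] at this
  have hfeq : twinFrame A₁ ν = wordFrame A₁ [μ] := by
    apply LinearIsometryEquiv.ext
    intro x
    rw [twinFrame_apply A₁ hν1, wordFrame_cons, LinearIsometryEquiv.trans_apply, reflection_unit_apply hμ1]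
    show A₁ x - (2 * ⟪A₁ x, ν⟫_ℝ) • ν = A₁ (x - (2 * ⟪x, μ⟫_ℝ) • μ)
    rw [map_sub, LinearIsometryEquiv.map_smul, hAμ, ← hAμ, LinearIsometryEquiv.inner_map_map]
  rw [hfeq] at hEq
  have himg := image_fccSlots_eq_of_image_fcc_eq A₁ (wordFrame A₁ [μ]) hEq
  have hmap := map_reflection_eq_of_image_eq A₁ (κ := []) (κ' := [μ]) (by simp) (by simp)
    (fun μ' hμ' => by rw [List.mem_singleton] at hμ'; subst hμ'; exact ⟨hμ1, hμmenu⟩) (by simp) himg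
  simp at hmap

section Row

variable {δ : ℝ} (hg : KissingGap δ) (hc : KissingClassification δ)
variable {sF : ℝ} (hsF : 0 < sF) (hsF' : sF ≤ 2 * Real.sqrt 6)
  (hrowW : ∀ L : EuclideanSpace ℝ (Fin 3) ≃ₗᵢ[ℝ] EuclideanSpace ℝ (Fin 3),
    LocalEndRow WordVersion.v1 sF ⟨L, inPlaneRoots L 1⟩
      ⟨((ℝ ∙ (EuclideanSpace.single (2 : Fin 3) (1 : ℝ))).reflection).trans L,
        inPlaneRoots (((ℝ ∙ (EuclideanSpace.single (2 : Fin 3) (1 : ℝ))).reflection).trans L) (-1)⟩)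
include hg hc hsF hsF' hrowW

open scoped Classical in
/-- **Debt 1 from the twin row.**  See the module docstring. -/
theorem coaxialTwoSlabAdhesionCoherentTwin_of_row : CoaxialTwoSlabAdhesionCoherentTwin := by
  intro A₁ t₁ A₂ t₂ hcoax hne hS
  obtain ⟨-, ν, hν1, hmenu, hA₂, -⟩ := hS
  have htwin : A₁ '' fccStacking 1 (Real.sqrt (2 / 3)) ≠ A₂ '' fccStacking 1 (Real.sqrt (2 / 3)) := by
    rw [hA₂]; exact image_ne_twinFrame A₁ hν1 hmenu
  obtain ⟨L, s₁, s₂, σ, σ', hσ, hσ', hsub₁, hsub₂⟩ := hcoax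
  set e₃ : EuclideanSpace ℝ (Fin 3) := EuclideanSpace.single (2 : Fin 3) (1 : ℝ) with he₃
  have hRR : ∀ L' : EuclideanSpace ℝ (Fin 3) ≃ₗᵢ[ℝ] EuclideanSpace ℝ (Fin 3),
      ((ℝ ∙ e₃).reflection).trans (((ℝ ∙ e₃).reflection).trans L') = L' := fun L' =>
    LinearIsometryEquiv.ext fun x => by
      simp only [LinearIsometryEquiv.trans_apply, Submodule.reflection_reflection]
  have hrow : ∀ F : Bool → (EuclideanSpace ℝ (Fin 3) ≃ₗᵢ[ℝ] EuclideanSpace ℝ (Fin 3)),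
      (F false = L ∧ F true = ((ℝ ∙ e₃).reflection).trans L ∨
        F false = ((ℝ ∙ e₃).reflection).trans L ∧ F true = L) →
      LocalEndRow WordVersion.v1 sF ⟨F false, inPlaneRoots (F false) 1⟩ ⟨F true, inPlaneRoots (F true) (-1)⟩ := by
    rintro F (⟨h0, h1⟩ | ⟨h0, h1⟩)
    · rw [h0, h1]; exact hrowW L
    · have := hrowW (((ℝ ∙ e₃).reflection).trans L)
      rw [hRR] at this
      rw [h0, h1]; exact this
  obtain ⟨C, R₀, hR₀, hmain⟩ := coaxialTwoSlabAdhesion_general_twin_of_row hg hc A₁ t₁ A₂ t₂ L s₁ s₂ σ σ'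
    hσ hσ' hsub₁ hsub₂ htwin hsF hsF' hrow
  exact ⟨L, s₁, s₂, σ, σ', hσ, hσ', hsub₁, hsub₂, C, R₀, hR₀, hmain⟩

end Row

end Summit.Ventures.Crystal3D.Theorems

end
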